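import Summits.AtomisticToContinuum.BoseEinsteinCondensation.Theses.BECConjugateDomination
import Summits.AtomisticToContinuum.BoseEinsteinCondensation.Theorems.HardCoreExtension.Negative.HighDensityObstruction
import Literature.MathematicalPhysics.QuantumManyBody.JelliumBoseGasCondensateDilation
import Literature.MathematicalPhysics.QuantumManyBody.BogoliubovSpectrumGPProofs

/-!
# `HardCoreExtension` (stmt-AtomisticToContinuum-11786): scaling reductions (negative lane, gen 2)

Second negative-lane file of the standing disprover of the crux
`BECConjugateDomination.HardCoreExtension = (smooth-class dilute BEC) → BoseEinsteinCondensation`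
(first file: `HighDensityObstruction.lean`, p73104). Nothing here asserts a Theses decl.

The tree's exact dilation symmetry of the Dirichlet Bose gas
(`JelliumBoseGas.condensateNumber_dilate`: `condensateNumber (s⁻²v(·/s)) N (sL) = condensateNumber v N L`,
`BoseGas.scalePotential s v = s⁻² v(·/s)`) is pushed to the objects of the crux:

* §A `hasGroundStateBEC_scalePotential_iff` — `HasGroundStateBEC (s⁻²v(·/s)) (ρ/s³) ↔ HasGroundStateBEC v ρ`;
  `diluteBEC_scalePotential_iff` — dilute BEC (`∃ ρ₀ ∀ ρ < ρ₀`) is dilation INVARIANT.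
* §B both classes of the crux are dilation invariant: `isRepulsiveFiniteRange_scalePotential`
  (conjunct side) and, clause by clause, the SMOOTH class of the antecedent (`scalePotential_ne_top`,
  `contDiff_scalePotential_profile`, `edgeCondition_scalePotential` — edge constant `s⁻³|Cₑ|`);
  `scatteringLength_scalePotential` (`𝔞(s⁻²v(·/s)) = s·𝔞(v)`, from the tree's `scatteringLength_scaledPotential`).
* §C QUANTIFIER ORDER IS LOAD-BEARING ON BOTH SIDES OF THE CRUX. Because the classes carry no length
  scale, a density threshold `ρ₀` uniform over a class is worth ALL densities:
  `smoothClass_uniformRho_iff_allDensities`, `conjunctClass_uniformRho_iff_allDensities`; hence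
  `not_conjunctClass_uniformRho` (hard spheres above `8/a³`, `not_hasGroundStateBEC_allDensities`):
  the conjunct with `∃ ρ₀ ∀ v` is FALSE, and the antecedent with `∃ ρ₀ ∀ v` is the all-density
  smooth-class BEC (expected false: quantum crystals) — a planner "uniformising" the antecedent
  must fix a length (range `R`, scattering length `a`), never `ρ₀` alone.
* §D RANGE IS A GAUGE: `smoothClassBEC_iff_unitRange`, `conjunct_iff_unitRange`,
  `hardCoreExtension_iff_unitRange` — antecedent, conjunct and crux are each equivalent to their
  restriction to potentials of range `≤ 1`; so the refuter-suggested `(a, R)`-uniform repair of the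
  antecedent has ONE genuine parameter, `a/R ∈ (0, 1]`.
-/

namespace Summit.AtomisticToContinuum.BoseEinsteinCondensation.Theorems.HardCoreExtension.Negative

open MeasureTheory Filter Metric
open scoped ENNReal Topology
open Literature.MathematicalPhysics.QuantumManyBody.BoseGas
open Literature.MathematicalPhysics.QuantumManyBody (JelliumBoseGas.sideLength_div_pow_three
  JelliumBoseGas.condensateNumber_dilate)

noncomputable section

/-! ## §A Dilation covariance of ground-state BEC -/

/-- **BEC at one density is dilation covariant**: `s⁻²v(·/s)` at density `ρ/s³` condenses iff `v`
does at density `ρ` (same `c`, same `N`: `L_N(ρ/s³) = s·L_N(ρ)` and `condensateNumber` is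
invariant under the unitary dilation, `JelliumBoseGas.condensateNumber_dilate`).
[cite: LSSY2005, Ch. 5, footnote to (5.3)] -/
theorem hasGroundStateBEC_scalePotential_iff (v : ℝ → ℝ≥0∞) {s ρ : ℝ} (hs : 0 < s) (hρ : 0 < ρ) :
    HasGroundStateBEC (scalePotential s v) (ρ / s ^ 3) ↔ HasGroundStateBEC v ρ := by
  unfold HasGroundStateBEC
  simp_rw [JelliumBoseGas.sideLength_div_pow_three hρ hs, JelliumBoseGas.condensateNumber_dilate v _ _ hs]

/-- The same with the density read on the scaled side: `BEC(s⁻²v(·/s), ρ) ↔ BEC(v, ρs³)`. [folklore] -/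
theorem hasGroundStateBEC_scalePotential_iff' (v : ℝ → ℝ≥0∞) {s ρ : ℝ} (hs : 0 < s) (hρ : 0 < ρ) :
    HasGroundStateBEC (scalePotential s v) ρ ↔ HasGroundStateBEC v (ρ * s ^ 3) := by
  have h3 : ρ * s ^ 3 / s ^ 3 = ρ := by field_simp
  simpa [h3] using hasGroundStateBEC_scalePotential_iff v hs (show 0 < ρ * s ^ 3 by positivity)

/-- **Dilute BEC is dilation invariant** (`ρ₀ ↦ ρ₀/s³`). [folklore] -/
theorem diluteBEC_scalePotential_iff (v : ℝ → ℝ≥0∞) {s : ℝ} (hs : 0 < s) :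
    (∃ ρ₀ : ℝ, 0 < ρ₀ ∧ ∀ ρ : ℝ, 0 < ρ → ρ < ρ₀ → HasGroundStateBEC (scalePotential s v) ρ) ↔
      ∃ ρ₀ : ℝ, 0 < ρ₀ ∧ ∀ ρ : ℝ, 0 < ρ → ρ < ρ₀ → HasGroundStateBEC v ρ := by
  have hs3 : 0 < s ^ 3 := by positivity
  constructor
  · rintro ⟨ρ₀, hρ₀, h⟩
    refine ⟨ρ₀ * s ^ 3, by positivity, fun ρ hρ hlt => ?_⟩
    have h1 : 0 < ρ / s ^ 3 := div_pos hρ hs3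
    have h2 : ρ / s ^ 3 < ρ₀ := by rw [div_lt_iff₀ hs3]; exact hlt
    exact (hasGroundStateBEC_scalePotential_iff v hs hρ).1 (h _ h1 h2)
  · rintro ⟨ρ₀, hρ₀, h⟩
    refine ⟨ρ₀ / s ^ 3, by positivity, fun ρ hρ hlt => ?_⟩
    have h2 : ρ * s ^ 3 < ρ₀ := by rwa [lt_div_iff₀ hs3] at hlt
    exact (hasGroundStateBEC_scalePotential_iff' v hs hρ).2 (h _ (by positivity) h2)

/-- Every density can be moved below any threshold by a dilation: `∃ s > 0, ρ/s³ < ρ₀`. [folklore] -/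
theorem exists_scale_density_lt {ρ ρ₀ : ℝ} (hρ : 0 < ρ) (hρ₀ : 0 < ρ₀) :
    ∃ s : ℝ, 0 < s ∧ ρ / s ^ 3 < ρ₀ := by
  refine ⟨ρ / ρ₀ + 1, by positivity, ?_⟩
  have hs1 : 1 ≤ ρ / ρ₀ + 1 := by
    have : 0 ≤ ρ / ρ₀ := by positivity
    linarith
  have hs0 : 0 < ρ / ρ₀ + 1 := by positivity
  have hle : ρ / (ρ / ρ₀ + 1) ^ 3 ≤ ρ / (ρ / ρ₀ + 1) := by
    refine div_le_div_of_nonneg_left hρ.le hs0 ?_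
    have h2 : ρ / ρ₀ + 1 ≤ (ρ / ρ₀ + 1) ^ 2 := by nlinarith
    nlinarith
  refine hle.trans_lt ?_
  rw [div_lt_iff₀ hs0]
  have : ρ₀ * (ρ / ρ₀ + 1) = ρ + ρ₀ := by field_simp
  linarith

/-! ## §B Both classes of the crux are dilation invariant -/

/-- The conjunct's class (measurable, finite range) is dilation invariant (range `R₀ ↦ sR₀`). [folklore] -/
theorem isRepulsiveFiniteRange_scalePotential {v : ℝ → ℝ≥0∞} (hv : IsRepulsiveFiniteRange v)
    {s : ℝ} (hs : 0 < s) : IsRepulsiveFiniteRange (scalePotential s v) := by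
  obtain ⟨hm, R₀, hR₀⟩ := hv
  refine ⟨measurable_const.mul (hm.comp (measurable_const.mul measurable_id)), s * R₀, fun r hr => ?_⟩
  have : R₀ < s⁻¹ * r := by
    rw [lt_inv_mul_iff₀ hs]; exact hr
  simp [scalePotential_apply, hR₀ _ this]

/-- Range bookkeeping: if `v` vanishes beyond `R₀` then `s⁻²v(·/s)` vanishes beyond `sR₀`. [folklore] -/
theorem scalePotential_eq_zero_of_lt {v : ℝ → ℝ≥0∞} {R₀ : ℝ} (hR₀ : ∀ r, R₀ < r → v r = 0)
    {s : ℝ} (hs : 0 < s) : ∀ r, s * R₀ < r → scalePotential s v r = 0 := by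
  intro r hr
  have : R₀ < s⁻¹ * r := by
    rw [lt_inv_mul_iff₀ hs]; exact hr
  simp [scalePotential_apply, hR₀ _ this]

/-- Finiteness is preserved. [folklore] -/
theorem scalePotential_ne_top {v : ℝ → ℝ≥0∞} (hfin : ∀ r, v r ≠ ⊤) (s r : ℝ) :
    scalePotential s v r ≠ ⊤ :=
  ENNReal.mul_ne_top ENNReal.ofReal_ne_top (hfin _)

/-- The radial profile of the scaled potential on `ℝ³` is `s⁻² · (ṽ ∘ s⁻¹)`. [folklore] -/
theorem scalePotential_profile_eq {v : ℝ → ℝ≥0∞} {s : ℝ} (hs : 0 < s) :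
    (fun x : Space => (scalePotential s v ‖x‖).toReal) =
      (s ^ 2)⁻¹ • ((fun x : Space => (v ‖x‖).toReal) ∘ fun x : Space => s⁻¹ • x) := by
  funext x
  simp only [scalePotential_apply, Pi.smul_apply, Function.comp_apply, smul_eq_mul,
    ENNReal.toReal_mul, ENNReal.toReal_ofReal (inv_nonneg.2 (sq_nonneg s))]
  rw [norm_smul, Real.norm_of_nonneg (inv_nonneg.2 hs.le)]

/-- The `C²` clause of the smooth class is preserved. [folklore] -/
theorem contDiff_scalePotential_profile {v : ℝ → ℝ≥0∞}
    (hC : ContDiff ℝ 2 fun x : Space => (v ‖x‖).toReal) {s : ℝ} (hs : 0 < s) :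
    ContDiff ℝ 2 fun x : Space => (scalePotential s v ‖x‖).toReal := by
  rw [scalePotential_profile_eq hs]
  exact (hC.comp (contDiff_id.const_smul s⁻¹)).const_smul ((s ^ 2)⁻¹)

/-- **The edge condition `‖D²ṽ‖ ≤ Cₑ√ṽ` is preserved**, with constant `s⁻³|Cₑ|`
(`D²(s⁻²ṽ(·/s)) = s⁻⁴(D²ṽ)(·/s)` and `√(s⁻²ṽ(·/s)) = s⁻¹√ṽ(·/s)`). [folklore] -/
theorem edgeCondition_scalePotential {v : ℝ → ℝ≥0∞}
    (hC : ContDiff ℝ 2 fun x : Space => (v ‖x‖).toReal)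
    (hedge : ∃ Cₑ : ℝ, ∀ x : Space,
      ‖iteratedFDeriv ℝ 2 (fun x : Space => (v ‖x‖).toReal) x‖ ≤ Cₑ * Real.sqrt ((v ‖x‖).toReal))
    {s : ℝ} (hs : 0 < s) :
    ∃ Cₑ : ℝ, ∀ x : Space,
      ‖iteratedFDeriv ℝ 2 (fun x : Space => (scalePotential s v ‖x‖).toReal) x‖ ≤
        Cₑ * Real.sqrt ((scalePotential s v ‖x‖).toReal) := by
  obtain ⟨Cₑ, hedge⟩ := hedge
  have hcomp : ContDiff ℝ 2 ((fun x : Space => (v ‖x‖).toReal) ∘ fun x : Space => s⁻¹ • x) :=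
    hC.comp (contDiff_id.const_smul s⁻¹)
  refine ⟨(s ^ 3)⁻¹ * |Cₑ|, fun x => ?_⟩
  rw [scalePotential_profile_eq hs, iteratedFDeriv_const_smul_apply hcomp.contDiffAt, norm_smul,
    Real.norm_of_nonneg (inv_nonneg.2 (sq_nonneg s))]
  set g : Space →L[ℝ] Space := s⁻¹ • ContinuousLinearMap.id ℝ Space with hg_def
  have hfg : ((fun x : Space => (v ‖x‖).toReal) ∘ fun x : Space => s⁻¹ • x) =
      (fun x : Space => (v ‖x‖).toReal) ∘ g := rfl
  have hnorm_g : ‖g‖ ≤ s⁻¹ := by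
    refine ContinuousLinearMap.opNorm_le_bound _ (inv_nonneg.2 hs.le) fun x => ?_
    show ‖s⁻¹ • x‖ ≤ s⁻¹ * ‖x‖
    rw [norm_smul, Real.norm_of_nonneg (inv_nonneg.2 hs.le)]
  have h2 : iteratedFDeriv ℝ 2 ((fun x : Space => (v ‖x‖).toReal) ∘ g) x =
      (iteratedFDeriv ℝ 2 (fun x : Space => (v ‖x‖).toReal) (g x)).compContinuousLinearMap
        fun _ => g :=
    g.iteratedFDeriv_comp_right hC x (i := 2) (by norm_cast)
  rw [hfg, h2]
  have hprod : ‖(iteratedFDeriv ℝ 2 (fun x : Space => (v ‖x‖).toReal) (g x)).compContinuousLinearMap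
        fun _ => g‖ ≤ ‖iteratedFDeriv ℝ 2 (fun x : Space => (v ‖x‖).toReal) (g x)‖ * (s⁻¹ * s⁻¹) := by
    refine (ContinuousMultilinearMap.norm_compContinuousLinearMap_le _ _).trans ?_
    rw [Fin.prod_univ_two]
    exact mul_le_mul_of_nonneg_left (mul_le_mul hnorm_g hnorm_g (norm_nonneg _)
      (inv_nonneg.2 hs.le)) (norm_nonneg _)
  have hgx : g x = s⁻¹ • x := rfl
  have hsq : Real.sqrt ((scalePotential s v ‖x‖).toReal) =
      s⁻¹ * Real.sqrt ((v ‖g x‖).toReal) := by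
    rw [scalePotential_apply, ENNReal.toReal_mul, ENNReal.toReal_ofReal (inv_nonneg.2 (sq_nonneg s)),
      Real.sqrt_mul (inv_nonneg.2 (sq_nonneg s)), Real.sqrt_inv, Real.sqrt_sq hs.le, hgx, norm_smul,
      Real.norm_of_nonneg (inv_nonneg.2 hs.le)]
  rw [hsq]
  have h0 : 0 ≤ Real.sqrt ((v ‖g x‖).toReal) := Real.sqrt_nonneg _
  have hD : ‖iteratedFDeriv ℝ 2 (fun x : Space => (v ‖x‖).toReal) (g x)‖ ≤
      |Cₑ| * Real.sqrt ((v ‖g x‖).toReal) :=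
    (hedge (g x)).trans (mul_le_mul_of_nonneg_right (le_abs_self _) h0)
  have hs2 : (0 : ℝ) ≤ (s ^ 2)⁻¹ := inv_nonneg.2 (sq_nonneg s)
  calc (s ^ 2)⁻¹ * ‖(iteratedFDeriv ℝ 2 (fun x : Space => (v ‖x‖).toReal) (g x)).compContinuousLinearMap
          fun _ => g‖
      ≤ (s ^ 2)⁻¹ * (|Cₑ| * Real.sqrt ((v ‖g x‖).toReal) * (s⁻¹ * s⁻¹)) := by
        refine mul_le_mul_of_nonneg_left (hprod.trans ?_) hs2
        exact mul_le_mul_of_nonneg_right hD (by positivity)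
    _ = (s ^ 3)⁻¹ * |Cₑ| * (s⁻¹ * Real.sqrt ((v ‖g x‖).toReal)) := by
        field_simp

/-- **Scattering length scales like a length**: `𝔞(s⁻²v(·/s)) = s·𝔞(v)` (the tree's
`scatteringLength_scaledPotential`, whose `scaledPotential v s = (ofReal s²)⁻¹ v(·/s)` is this file's
`scalePotential s v`). [cite: LSSY2005, Ch. 5 (5.3)] -/
theorem scatteringLength_scalePotential (v : ℝ → ℝ≥0∞) {s : ℝ} (hs : 0 < s) :
    scatteringLength (scalePotential s v) = ENNReal.ofReal s * scatteringLength v := by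
  have h : Literature.Barriers.AtomisticToContinuum.BoseGas.scaledPotential v s = scalePotential s v := by
    funext r
    simp only [Literature.Barriers.AtomisticToContinuum.BoseGas.scaledPotential, scalePotential_apply]
    rw [ENNReal.ofReal_inv_of_pos (by positivity : (0:ℝ) < s ^ 2), div_eq_inv_mul]
  rw [← h, scatteringLength_scaledPotential v hs]

/-! ## §C Quantifier order: a class-uniform `ρ₀` is worth all densities -/

/-- **Uniform threshold ⇔ all densities, smooth class.** A density threshold `ρ₀` uniform over the
antecedent's (scale-free) smooth class is equivalent to ground-state BEC at EVERY density for every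
smooth-class potential: dilate `v` until `ρ/s³ < ρ₀`. The right side is expected to be FALSE
(crystallisation of soft spheres at high density), so the `∃ ρ₀ ∀ v` form of the antecedent is no
admissible repair — a uniformisation must fix a length scale (§D). [folklore] -/
theorem smoothClass_uniformRho_iff_allDensities :
    (∃ ρ₀ : ℝ, 0 < ρ₀ ∧ ∀ v : ℝ → ℝ≥0∞, IsRepulsiveFiniteRange v → (∀ r, v r ≠ ⊤) →
        ContDiff ℝ 2 (fun x : Space => (v ‖x‖).toReal) →
        (∃ Cₑ : ℝ, ∀ x : Space, ‖iteratedFDeriv ℝ 2 (fun x : Space => (v ‖x‖).toReal) x‖ ≤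
            Cₑ * Real.sqrt ((v ‖x‖).toReal)) →
        ∀ ρ : ℝ, 0 < ρ → ρ < ρ₀ → HasGroundStateBEC v ρ) ↔
      ∀ v : ℝ → ℝ≥0∞, IsRepulsiveFiniteRange v → (∀ r, v r ≠ ⊤) →
        ContDiff ℝ 2 (fun x : Space => (v ‖x‖).toReal) →
        (∃ Cₑ : ℝ, ∀ x : Space, ‖iteratedFDeriv ℝ 2 (fun x : Space => (v ‖x‖).toReal) x‖ ≤
            Cₑ * Real.sqrt ((v ‖x‖).toReal)) →
        ∀ ρ : ℝ, 0 < ρ → HasGroundStateBEC v ρ := by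
  constructor
  · rintro ⟨ρ₀, hρ₀, h⟩ v hv hfin hC hedge ρ hρ
    obtain ⟨s, hs, hlt⟩ := exists_scale_density_lt hρ hρ₀
    exact (hasGroundStateBEC_scalePotential_iff v hs hρ).1
      (h _ (isRepulsiveFiniteRange_scalePotential hv hs) (scalePotential_ne_top hfin s)
        (contDiff_scalePotential_profile hC hs) (edgeCondition_scalePotential hC hedge hs) _
        (by positivity) hlt)
  · intro h
    exact ⟨1, one_pos, fun v hv hfin hC hedge ρ hρ _ => h v hv hfin hC hedge ρ hρ⟩

/-- **Uniform threshold ⇔ all densities, conjunct's class.** [folklore] -/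
theorem conjunctClass_uniformRho_iff_allDensities :
    (∃ ρ₀ : ℝ, 0 < ρ₀ ∧ ∀ v : ℝ → ℝ≥0∞, IsRepulsiveFiniteRange v →
        ∀ ρ : ℝ, 0 < ρ → ρ < ρ₀ → HasGroundStateBEC v ρ) ↔
      ∀ v : ℝ → ℝ≥0∞, IsRepulsiveFiniteRange v → ∀ ρ : ℝ, 0 < ρ → HasGroundStateBEC v ρ := by
  constructor
  · rintro ⟨ρ₀, hρ₀, h⟩ v hv ρ hρ
    obtain ⟨s, hs, hlt⟩ := exists_scale_density_lt hρ hρ₀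
    exact (hasGroundStateBEC_scalePotential_iff v hs hρ).1
      (h _ (isRepulsiveFiniteRange_scalePotential hv hs) _ (by positivity) hlt)
  · intro h
    exact ⟨1, one_pos, fun v hv ρ hρ _ => h v hv ρ hρ⟩

/-- **The conjunct with a `v`-uniform density threshold is FALSE**: `∃ ρ₀ > 0 ∀ v ∀ ρ < ρ₀, BEC(v, ρ)`
fails (it would give BEC at all densities, refuted by hard spheres above `8/a³`,
`not_hasGroundStateBEC_allDensities`). So the order `∀ v ∃ ρ₀` in `BoseEinsteinCondensation` — and
in the conclusion of the crux — is load-bearing. [folklore] -/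
theorem not_conjunctClass_uniformRho :
    ¬ ∃ ρ₀ : ℝ, 0 < ρ₀ ∧ ∀ v : ℝ → ℝ≥0∞, IsRepulsiveFiniteRange v →
        ∀ ρ : ℝ, 0 < ρ → ρ < ρ₀ → HasGroundStateBEC v ρ := fun h =>
  not_hasGroundStateBEC_allDensities (conjunctClass_uniformRho_iff_allDensities.1 h)

/-! ## §D Range is a gauge: unit-range normal forms of antecedent, conjunct and crux -/

/-- **The antecedent is its unit-range case**: smooth-class dilute BEC for all smooth-class `v`
iff for those of range `≤ 1` (dilate by `s = 1/R`). [folklore] -/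
theorem smoothClassBEC_iff_unitRange :
    (∀ v : ℝ → ℝ≥0∞, IsRepulsiveFiniteRange v → (∀ r, v r ≠ ⊤) →
        ContDiff ℝ 2 (fun x : Space => (v ‖x‖).toReal) →
        (∃ Cₑ : ℝ, ∀ x : Space, ‖iteratedFDeriv ℝ 2 (fun x : Space => (v ‖x‖).toReal) x‖ ≤
            Cₑ * Real.sqrt ((v ‖x‖).toReal)) →
        ∃ ρ₀ : ℝ, 0 < ρ₀ ∧ ∀ ρ : ℝ, 0 < ρ → ρ < ρ₀ → HasGroundStateBEC v ρ) ↔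
      ∀ v : ℝ → ℝ≥0∞, IsRepulsiveFiniteRange v → (∀ r, v r ≠ ⊤) →
        ContDiff ℝ 2 (fun x : Space => (v ‖x‖).toReal) →
        (∃ Cₑ : ℝ, ∀ x : Space, ‖iteratedFDeriv ℝ 2 (fun x : Space => (v ‖x‖).toReal) x‖ ≤
            Cₑ * Real.sqrt ((v ‖x‖).toReal)) →
        (∀ r, 1 < r → v r = 0) →
        ∃ ρ₀ : ℝ, 0 < ρ₀ ∧ ∀ ρ : ℝ, 0 < ρ → ρ < ρ₀ → HasGroundStateBEC v ρ := by
  refine ⟨fun h v hv hfin hC hedge _ => h v hv hfin hC hedge, fun h v hv hfin hC hedge => ?_⟩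
  obtain ⟨R, hR, hvR⟩ := hv.exists_pos_range
  have hs : 0 < R⁻¹ := inv_pos.2 hR
  have hunit : ∀ r, 1 < r → scalePotential R⁻¹ v r = 0 := by
    intro r hr
    refine scalePotential_eq_zero_of_lt hvR hs r ?_
    rwa [inv_mul_cancel₀ hR.ne']
  exact (diluteBEC_scalePotential_iff v hs).1
    (h _ (isRepulsiveFiniteRange_scalePotential hv hs) (scalePotential_ne_top hfin _)
      (contDiff_scalePotential_profile hC hs) (edgeCondition_scalePotential hC hedge hs) hunit)

/-- **The conjunct is its unit-range case.** [folklore] -/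
theorem conjunct_iff_unitRange :
    Literature.MathematicalPhysics.QuantumManyBody.BoseGas.BoseEinsteinCondensation ↔
      ∀ v : ℝ → ℝ≥0∞, IsRepulsiveFiniteRange v → (∀ r, 1 < r → v r = 0) →
        ∃ ρ₀ : ℝ, 0 < ρ₀ ∧ ∀ ρ : ℝ, 0 < ρ → ρ < ρ₀ → HasGroundStateBEC v ρ := by
  refine ⟨fun h v hv _ => h v hv, fun h v hv => ?_⟩
  obtain ⟨R, hR, hvR⟩ := hv.exists_pos_range
  have hs : 0 < R⁻¹ := inv_pos.2 hR
  have hunit : ∀ r, 1 < r → scalePotential R⁻¹ v r = 0 := by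
    intro r hr
    refine scalePotential_eq_zero_of_lt hvR hs r ?_
    rwa [inv_mul_cancel₀ hR.ne']
  exact (diluteBEC_scalePotential_iff v hs).1 (h _ (isRepulsiveFiniteRange_scalePotential hv hs) hunit)

/-- **The crux is its unit-range case**: `HardCoreExtension` iff "unit-range smooth-class dilute BEC
implies unit-range dilute BEC for every repulsive finite-range potential". In particular the
`(a, R)`-uniform repair of the antecedent proposed by the refuters (uniform constants over
`{v smooth : 𝔞(v) ≤ a, range ≤ R}`) may take `R = 1` without loss: by §A–§B and
`scatteringLength_scalePotential` its only genuine parameter is `a/R ∈ (0, 1]`. [folklore] -/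
theorem hardCoreExtension_iff_unitRange :
    Theses.BECConjugateDomination.HardCoreExtension ↔
      ((∀ v : ℝ → ℝ≥0∞, IsRepulsiveFiniteRange v → (∀ r, v r ≠ ⊤) →
          ContDiff ℝ 2 (fun x : Space => (v ‖x‖).toReal) →
          (∃ Cₑ : ℝ, ∀ x : Space, ‖iteratedFDeriv ℝ 2 (fun x : Space => (v ‖x‖).toReal) x‖ ≤
              Cₑ * Real.sqrt ((v ‖x‖).toReal)) →
          (∀ r, 1 < r → v r = 0) →
          ∃ ρ₀ : ℝ, 0 < ρ₀ ∧ ∀ ρ : ℝ, 0 < ρ → ρ < ρ₀ → HasGroundStateBEC v ρ) →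
        ∀ v : ℝ → ℝ≥0∞, IsRepulsiveFiniteRange v → (∀ r, 1 < r → v r = 0) →
          ∃ ρ₀ : ℝ, 0 < ρ₀ ∧ ∀ ρ : ℝ, 0 < ρ → ρ < ρ₀ → HasGroundStateBEC v ρ) := by
  show (_ → Literature.MathematicalPhysics.QuantumManyBody.BoseGas.BoseEinsteinCondensation) ↔ _
  rw [conjunct_iff_unitRange, smoothClassBEC_iff_unitRange]

end

end Summit.AtomisticToContinuum.BoseEinsteinCondensation.Theorems.HardCoreExtension.Negative
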